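/-
Copyright (c) 2026 the pub-hodgecm-mathlib formalisation cell (harness21).  Prover seat hodgecm-mathlib-R90-C14-p01 (g0), HCML SLAB R90-TF,
section S3 «§12.7 endoscopic character identities» (base `R90-C12`), DEAL S3 WAVE 5 (W5-d) PAYER (successor S3 dealer R90-C12-plan (g2),
memo `R90/R90-C12-plan/g2/DEAL-S3-WAVE5-L492General.md`, R90 bus 2026-09-04T23:04:59Z).  2026-09-04.
-/
import Summits.HodgeConjecture.HodgeConjecture.Theorems.R90S3EndoExpansionIndPS             -- ★ p03's packaging: the `h492` frame (A1 vocabulary, `finExplicitCollection`, `cmPrincipalSeriesH`)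
import Summits.HodgeConjecture.HodgeConjecture.Theorems.R90S3ConstituentPSContinuous       -- ★ p862949 (W5-c): `continuous_of_isConstituentOf_cmPrincipalSeriesH`
import Summits.HodgeConjecture.HodgeConjecture.Theorems.R90S3InducedCharTransferSignedGeneral  -- ★ p863089 (W5-a, K2E3-p21): `inducedCharTransferSigned_general`
import Summits.HodgeConjecture.HodgeConjecture.Theorems.R90S3PrincipalSeriesFiniteLength   -- ★ `isFiniteLength_cmPrincipalSeries_three`
import Summits.HodgeConjecture.HodgeConjecture.Theorems.F0P3XiUnramNonsplitInstance        -- ★ `isAdmissible_cmPrincipalSeries`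
import Literature.NumberTheory.Automorphic.HermitianFormNonsplitPlaceFrame                  -- ★ `HermitianFrame.exists_formCongr_conjLocal_eq_smul_antidiag_three`
import Literature.NumberTheory.Automorphic.LocalUnitaryGroupCongr                           -- ★ `cmDatumLocalCongr`
import Literature.NumberTheory.Automorphic.SmoothIndTransport                               -- ★ `isFiniteLength_iff_of_equivariant_equiv` (W5-b′ by name)
import Literature.NumberTheory.Automorphic.UnitaryGroupLocalTypeSpherical                   -- ★ `isAdmissible_comp_continuousMulEquiv`
import HarnessLib

/-!
# R90 · S3 — WAVE 5 (W5-d) PAYER of E's socket `stub_R90_S3_print_492_indPS`: Lemma 4.9.2 SIGNED at general `(χ₂, χ₁)` + finite length of `i_G(χ̃)`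
# (`Theorems/R90S3Print492IndPS.lean`)

Cell `hodgecm-mathlib`, crux H413 (`stmt-HodgeConjecture-24833`), route of record `HCCMUnconditional`; programme R90-TF, section S3 (base `R90-C12`),
seat R90-C14-p01 (g0).  §1 `print_492_indPS_of_signedTransfer` packages the (W5-a) identity (as a hypothesis `hW5a` of ★ p863089's head shape) with a hermitian
frame, admissibility and finite length; §2 `print_492_indPS` = THE PAYER (E's socket conclusion verbatim) := ★ W5-c + ★ W5-a + §1.  Helper lane
`--supports stmt-HodgeConjecture-24833 --as helper`; THEOREMS ONLY (no definition, no instance, no notation, no `sorry`); never imports `Cruxes/…/Lines`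
(hence the socket's `hρ : R90.S4.IsRogPacketH …` binder, idle in the proof, is not repeated; the plug passes the remaining binders by name).
Heartbeats: `maxHeartbeats 400000` (2× default) on §1 only — the carrier unification `(cmDatum L 3 Φ₃).Local v = U(Φ₃)_v` behind `i_G(χ̃) ∘ e⁻¹`
(★ p863089 itself runs at 6 400 000); §2 at default.

THE MATHEMATICS [Rogawski1990, §4.9 Lemma 4.9.2 pp. 55–56; §12.1 p. 171; §13.1 p. 198].  For `(χ₂, χ₁)` with `i_H(χ₂ ⊠ χ₁)` having a constituent in `ρ`,
`χ₂` is continuous (★ W5-c).  The signed Lemma 4.9.2 (W5-a) gives a continuous `χ̃` on the torus of `U(Φ₃)_v` with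
`Tr i_H(χ₂ ⊠ χ₁)(f^H) = ε(a) · Tr (i_G(χ̃) ∘ e⁻¹)(f)` for every frame `ᵗT̄ H′_v T = a Φ₃` (`e = cmDatumLocalCongr`), `ε(a) = ±1`; a frame exists at the non-split
`v` (★ `HermitianFrame.exists_formCongr_conjLocal_eq_smul_antidiag_three`); `I := i_G(χ̃) ∘ e⁻¹` is admissible (★ `isAdmissible_cmPrincipalSeries` + ★
transport) and of finite length (★ `isFiniteLength_cmPrincipalSeries_three` + ★ `isFiniteLength_iff_of_equivariant_equiv`).
HONEST LABEL: HC_CM is proved only modulo the 7 printed citations (2 remaining named inputs: hLiu418 = stmt-HodgeConjecture-24832, h413 =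
stmt-HodgeConjecture-24833) until rung 0 closes; count-neutral.
-/

-- the mandated namespace repeats the single-problem summit's segment (`HodgeConjecture.HodgeConjecture`)
set_option linter.dupNamespace false
set_option autoImplicit false

noncomputable section

namespace Summit.HodgeConjecture.HodgeConjecture.R90.S3

open MeasureTheory IsDedekindDomain NumberField
open Literature.NumberTheory Literature.NumberTheory.Automorphic Literature.NumberTheory.Automorphic.UnitaryGroup
open Literature.NumberTheory.Rogawski1990 Literature.NumberTheory.GaloisRepresentations
open Summit.HodgeConjecture.HodgeConjecture.Cruxes.H413
open scoped Matrix

variable (L : Type) [Field L] [NumberField L] [IsCMField L] (H' : Matrix (Fin 3) (Fin 3) L)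
  (v : HeightOneSpectrum (𝓞 ↥(maximalRealSubfield L)))

set_option maxHeartbeats 400000 in
open scoped Classical in
/-- **(W5-d) modulo (W5-a) — Lemma 4.9.2 SIGNED ⇒ E's `h492` package**: from the signed transfer identity for `i_H(χ₂ ⊠ χ₁)` (hypothesis `hW5a`, the
(W5-a) head at this `(χ₂, χ₁)`), a hermitian frame at the non-split `v` and the ★ admissibility ∕ finite length of `i_G(χ̃)`, the package
`∃ ε I, I admissible ∧ finite length ∧ Tr i_H(χ₂ ⊠ χ₁)(f^H) = ε · Tr I(f)`. [cite: Rogawski1990, §4.9 Lemma 4.9.2 pp. 55–56; §12.1 p. 171; §13.1 p. 198] -/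
theorem print_492_indPS_of_signedTransfer
    (hH' : (H'.map (cmConjRingHom L))ᵀ = H') (hH'd : IsUnit H'.det)
    (μ : HeckeCharacter L)
    (hv : ∀ w : UnitaryGroup.PlacesOver L v, IsCMField.complexConj L • w.1 = w.1)
    [MeasurableSpace ((UnitaryGroup.cmDatum L 3 H').Local v)] [BorelSpace ((UnitaryGroup.cmDatum L 3 H').Local v)]
    [MeasurableSpace ((UnitaryGroup.cmDatum L 2 (Matrix.of fun i j : Fin 2 => if i.val + j.val + 1 = 2 then (1 : L) else 0)).Local v ×
      (UnitaryGroup.cmDatum L 1 (Matrix.of fun i j : Fin 1 => if i.val + j.val + 1 = 1 then (1 : L) else 0)).Local v)]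
    [BorelSpace ((UnitaryGroup.cmDatum L 2 (Matrix.of fun i j : Fin 2 => if i.val + j.val + 1 = 2 then (1 : L) else 0)).Local v ×
      (UnitaryGroup.cmDatum L 1 (Matrix.of fun i j : Fin 1 => if i.val + j.val + 1 = 1 then (1 : L) else 0)).Local v)]
    [∀ a : ((UnitaryGroup.cmDatum L 2 (Matrix.of fun i j : Fin 2 => if i.val + j.val + 1 = 2 then (1 : L) else 0)).Local v ×
      (UnitaryGroup.cmDatum L 1 (Matrix.of fun i j : Fin 1 => if i.val + j.val + 1 = 1 then (1 : L) else 0)).Local v),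
      MeasurableSpace (((UnitaryGroup.cmDatum L 2 (Matrix.of fun i j : Fin 2 => if i.val + j.val + 1 = 2 then (1 : L) else 0)).Local v ×
      (UnitaryGroup.cmDatum L 1 (Matrix.of fun i j : Fin 1 => if i.val + j.val + 1 = 1 then (1 : L) else 0)).Local v) ⧸
        Subgroup.centralizer ({a} : Set ((UnitaryGroup.cmDatum L 2 (Matrix.of fun i j : Fin 2 => if i.val + j.val + 1 = 2 then (1 : L) else 0)).Local v ×
      (UnitaryGroup.cmDatum L 1 (Matrix.of fun i j : Fin 1 => if i.val + j.val + 1 = 1 then (1 : L) else 0)).Local v)))]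
    [∀ a : ((UnitaryGroup.cmDatum L 2 (Matrix.of fun i j : Fin 2 => if i.val + j.val + 1 = 2 then (1 : L) else 0)).Local v ×
      (UnitaryGroup.cmDatum L 1 (Matrix.of fun i j : Fin 1 => if i.val + j.val + 1 = 1 then (1 : L) else 0)).Local v),
      BorelSpace (((UnitaryGroup.cmDatum L 2 (Matrix.of fun i j : Fin 2 => if i.val + j.val + 1 = 2 then (1 : L) else 0)).Local v ×
      (UnitaryGroup.cmDatum L 1 (Matrix.of fun i j : Fin 1 => if i.val + j.val + 1 = 1 then (1 : L) else 0)).Local v) ⧸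
        Subgroup.centralizer ({a} : Set ((UnitaryGroup.cmDatum L 2 (Matrix.of fun i j : Fin 2 => if i.val + j.val + 1 = 2 then (1 : L) else 0)).Local v ×
      (UnitaryGroup.cmDatum L 1 (Matrix.of fun i j : Fin 1 => if i.val + j.val + 1 = 1 then (1 : L) else 0)).Local v)))]
    [∀ γ : ((UnitaryGroup.cmDatum L 3 H').Local v), MeasurableSpace (((UnitaryGroup.cmDatum L 3 H').Local v) ⧸ Subgroup.centralizer ({γ} : Set ((UnitaryGroup.cmDatum L 3 H').Local v)))]
    [∀ γ : ((UnitaryGroup.cmDatum L 3 H').Local v), BorelSpace (((UnitaryGroup.cmDatum L 3 H').Local v) ⧸ Subgroup.centralizer ({γ} : Set ((UnitaryGroup.cmDatum L 3 H').Local v)))]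
    (νG : Measure ((UnitaryGroup.cmDatum L 3 H').Local v)) [νG.IsHaarMeasure] [νG.IsMulRightInvariant]
    (νH : Measure ((UnitaryGroup.cmDatum L 2 (Matrix.of fun i j : Fin 2 => if i.val + j.val + 1 = 2 then (1 : L) else 0)).Local v ×
      (UnitaryGroup.cmDatum L 1 (Matrix.of fun i j : Fin 1 => if i.val + j.val + 1 = 1 then (1 : L) else 0)).Local v))
    [νH.IsHaarMeasure] [νH.IsMulRightInvariant]
    (mH : OrbitalMeasureFamily ((UnitaryGroup.cmDatum L 2 (Matrix.of fun i j : Fin 2 => if i.val + j.val + 1 = 2 then (1 : L) else 0)).Local v ×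
      (UnitaryGroup.cmDatum L 1 (Matrix.of fun i j : Fin 1 => if i.val + j.val + 1 = 1 then (1 : L) else 0)).Local v))
    (mG : OrbitalMeasureFamily ((UnitaryGroup.cmDatum L 3 H').Local v))
    (χ₂ : ↥(torusU (conjLocal L (IsCMField.complexConj L) v) (cmLocalForm L 2 v)) →* ℂˣ)
    (χ₁ : (UnitaryGroup.cmDatum L 1 (Matrix.of fun i j : Fin 1 => if i.val + j.val + 1 = 1 then (1 : L) else 0)).Local v →* ℂˣ)
    (hW5a : ∃ χt : ↥(torusU (conjLocal L (IsCMField.complexConj L) v) (cmLocalForm L 3 v)) →* ℂˣ,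
      (Continuous fun t => ((χt t : ℂˣ) : ℂ)) ∧
      ∀ (T : GL (Fin 3) (UnitaryGroup.LocalRing L v)) (a : UnitaryGroup.LocalRing L v) (ha : IsUnit a)
        (h : formCongr (conjLocal L (IsCMField.complexConj L) v) T (H'.map (algebraMap L (UnitaryGroup.LocalRing L v))) =
          a • (Matrix.of fun i j : Fin 3 => if i.val + j.val + 1 = 3 then (1 : L) else 0).map (algebraMap L (UnitaryGroup.LocalRing L v)))
        (fH : (UnitaryGroup.cmDatum L 2 (Matrix.of fun i j : Fin 2 => if i.val + j.val + 1 = 2 then (1 : L) else 0)).Local v ×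
            (UnitaryGroup.cmDatum L 1 (Matrix.of fun i j : Fin 1 => if i.val + j.val + 1 = 1 then (1 : L) else 0)).Local v → ℂ)
        (f : (UnitaryGroup.cmDatum L 3 H').Local v → ℂ), IsLocSmooth fH → IsLocSmooth f →
        IsLocalDeltaTransfer L H' v
          (finExplicitCollection L H' μ (finExplicitDelta_conj_left_all L H' μ) (finExplicitDelta_conj_right_all L H' μ) v) mH mG fH f →
        (cmPrincipalSeriesH L v χ₂ χ₁).smoothTrace νH fH =
          (if ∃ z : UnitaryGroup.LocalRing L v, IsUnit z ∧ a = z * conjLocal L (IsCMField.complexConj L) v z then (1 : ℂ) else -1) *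
            Representation.smoothTrace
              ((haveI := locallyCompactSpace_cmBorelU L 3 v; cmPrincipalSeries L 3 v χt).comp
                (cmDatumLocalCongr L v T ha h).symm.toMulEquiv.toMonoidHom) νG f) :
    ∃ (ε : ℤ) (W : Type) (_ : AddCommGroup W) (_ : Module ℂ W) (I : Representation ℂ ((UnitaryGroup.cmDatum L 3 H').Local v) W),
      I.IsAdmissible ∧ IsFiniteLength (MonoidAlgebra ℂ ((UnitaryGroup.cmDatum L 3 H').Local v)) I.asModule ∧
      ∀ (fH : (UnitaryGroup.cmDatum L 2 (Matrix.of fun i j : Fin 2 => if i.val + j.val + 1 = 2 then (1 : L) else 0)).Local v ×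
          (UnitaryGroup.cmDatum L 1 (Matrix.of fun i j : Fin 1 => if i.val + j.val + 1 = 1 then (1 : L) else 0)).Local v → ℂ)
        (f : (UnitaryGroup.cmDatum L 3 H').Local v → ℂ),
        IsLocSmooth fH → IsLocSmooth f →
          IsLocalDeltaTransfer L H' v
            (finExplicitCollection L H' μ (finExplicitDelta_conj_left_all L H' μ) (finExplicitDelta_conj_right_all L H' μ) v) mH mG fH f →
          (cmPrincipalSeriesH L v χ₂ χ₁).smoothTrace νH fH = (ε : ℂ) * I.smoothTrace νG f := by
  obtain ⟨χt, _hχt, hId⟩ := hW5a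
  -- a hermitian frame `ᵗT̄ H′_v T = a • Φ₃` at the non-split place
  obtain ⟨w⟩ : Nonempty (UnitaryGroup.PlacesOver L v) := inferInstance
  have key := HermitianFrame.exists_formCongr_conjLocal_eq_smul_antidiag_three L H' hH' hH'd.ne_zero w (hv w)
  obtain ⟨T, a, ha, _hσa, h⟩ := key
  -- the transported principal series `I := i_G(χ̃) ∘ e⁻¹`, `e = cmDatumLocalCongr L v T ha h : U(Φ₃)_v ≃ₜ* U(H′)_v`
  have hadm0 := F0P3XiUnramNonsplitInstance.isAdmissible_cmPrincipalSeries L v χt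
  have hadm := isAdmissible_comp_continuousMulEquiv hadm0 (cmDatumLocalCongr L v T ha h).symm
  have hfl0 := isFiniteLength_cmPrincipalSeries_three L v hv χt
  have hfl := (Representation.isFiniteLength_iff_of_equivariant_equiv
      (ρ' := (cmPrincipalSeries L 3 v χt).comp (cmDatumLocalCongr L v T ha h).symm.toMulEquiv.toMonoidHom)
      (ρ := cmPrincipalSeries L 3 v χt)
      (cmDatumLocalCongr L v T ha h).symm.toMulEquiv (LinearEquiv.refl ℂ _) (fun _ _ => rfl)).2 hfl0
  refine ⟨if ∃ z : UnitaryGroup.LocalRing L v, IsUnit z ∧ a = z * conjLocal L (IsCMField.complexConj L) v z then 1 else -1,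
    _, inferInstance, inferInstance, _, hadm, hfl, fun fH f hfH hf hΔ => ?_⟩
  -- the signed identity, with the sign read as an integer
  refine (hId T a ha h fH f hfH hf hΔ).trans ?_
  congr 1
  split_ifs <;> simp

/-! ## §2 The payer -/

open scoped Classical in
/-- **(W5-d) PAYER of E's print socket `stub_R90_S3_print_492_indPS` — Lemma 4.9.2 SIGNED (transfer commutes with parabolic induction) + finite
length of `i_G(χ̃)`, in p03's packaging** (socket binders of `Cruxes/H413/Lines/R90_S3_PrintInputsE.lean` :205–:236 minus the idle `hμu`, `hT`, `hρ`;
conclusion :237–:252 VERBATIM): for every pair `(χ₂, χ₁)` (`χ₁` smooth) whose `i_H(χ₂ ⊠ χ₁)` has a constituent in the packet `ρ`, there are `ε : ℤ` and an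
ADMISSIBLE FINITE-LENGTH representation `I` of `G_v` (`I = i_G(χ̃) ∘ e⁻¹`, `ε = ±1`) with `Tr i_H(χ₂ ⊠ χ₁)(f^H) = ε · Tr I(f)` for all `Δ‴_v`-matched smooth
`(f^H, f)`.  PROOF: `χ₂` is continuous (★ W5-c `continuous_of_isConstituentOf_cmPrincipalSeriesH`); ★ W5-a `inducedCharTransferSigned_general` gives `χ̃` and
the signed identity for every frame; §1 packages it. [cite: Rogawski1990, §4.9 Lemma 4.9.2 pp. 55–56; §12.1 p. 171; §13.1 Thm. 13.1.1 (2) p. 198, p. 199]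
[cite: vanDijk1972, Thm. p. 237] -/
theorem print_492_indPS
    (hH' : (H'.map (cmConjRingHom L))ᵀ = H') (hH'd : IsUnit H'.det)
    (μ : HeckeCharacter L)
    (hμω : ∀ x : Literature.NumberTheory.GaloisRepresentations.ideleGroup ↥(maximalRealSubfield L),
      μ (AdeleRing.ideleBaseChange (↥(maximalRealSubfield L)) L x) = quadraticHeckeCharCM L x)
    (hv : ∀ w : UnitaryGroup.PlacesOver L v, IsCMField.complexConj L • w.1 = w.1)
    [MeasurableSpace ((UnitaryGroup.cmDatum L 3 H').Local v)] [BorelSpace ((UnitaryGroup.cmDatum L 3 H').Local v)]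
    [MeasurableSpace ((UnitaryGroup.cmDatum L 2 (Matrix.of fun i j : Fin 2 => if i.val + j.val + 1 = 2 then (1 : L) else 0)).Local v ×
      (UnitaryGroup.cmDatum L 1 (Matrix.of fun i j : Fin 1 => if i.val + j.val + 1 = 1 then (1 : L) else 0)).Local v)]
    [BorelSpace ((UnitaryGroup.cmDatum L 2 (Matrix.of fun i j : Fin 2 => if i.val + j.val + 1 = 2 then (1 : L) else 0)).Local v ×
      (UnitaryGroup.cmDatum L 1 (Matrix.of fun i j : Fin 1 => if i.val + j.val + 1 = 1 then (1 : L) else 0)).Local v)]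
    [∀ a : ((UnitaryGroup.cmDatum L 2 (Matrix.of fun i j : Fin 2 => if i.val + j.val + 1 = 2 then (1 : L) else 0)).Local v ×
      (UnitaryGroup.cmDatum L 1 (Matrix.of fun i j : Fin 1 => if i.val + j.val + 1 = 1 then (1 : L) else 0)).Local v),
      MeasurableSpace (((UnitaryGroup.cmDatum L 2 (Matrix.of fun i j : Fin 2 => if i.val + j.val + 1 = 2 then (1 : L) else 0)).Local v ×
      (UnitaryGroup.cmDatum L 1 (Matrix.of fun i j : Fin 1 => if i.val + j.val + 1 = 1 then (1 : L) else 0)).Local v) ⧸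
        Subgroup.centralizer ({a} : Set ((UnitaryGroup.cmDatum L 2 (Matrix.of fun i j : Fin 2 => if i.val + j.val + 1 = 2 then (1 : L) else 0)).Local v ×
      (UnitaryGroup.cmDatum L 1 (Matrix.of fun i j : Fin 1 => if i.val + j.val + 1 = 1 then (1 : L) else 0)).Local v)))]
    [∀ a : ((UnitaryGroup.cmDatum L 2 (Matrix.of fun i j : Fin 2 => if i.val + j.val + 1 = 2 then (1 : L) else 0)).Local v ×
      (UnitaryGroup.cmDatum L 1 (Matrix.of fun i j : Fin 1 => if i.val + j.val + 1 = 1 then (1 : L) else 0)).Local v),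
      BorelSpace (((UnitaryGroup.cmDatum L 2 (Matrix.of fun i j : Fin 2 => if i.val + j.val + 1 = 2 then (1 : L) else 0)).Local v ×
      (UnitaryGroup.cmDatum L 1 (Matrix.of fun i j : Fin 1 => if i.val + j.val + 1 = 1 then (1 : L) else 0)).Local v) ⧸
        Subgroup.centralizer ({a} : Set ((UnitaryGroup.cmDatum L 2 (Matrix.of fun i j : Fin 2 => if i.val + j.val + 1 = 2 then (1 : L) else 0)).Local v ×
      (UnitaryGroup.cmDatum L 1 (Matrix.of fun i j : Fin 1 => if i.val + j.val + 1 = 1 then (1 : L) else 0)).Local v)))]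
    [∀ γ : ((UnitaryGroup.cmDatum L 3 H').Local v), MeasurableSpace (((UnitaryGroup.cmDatum L 3 H').Local v) ⧸ Subgroup.centralizer ({γ} : Set ((UnitaryGroup.cmDatum L 3 H').Local v)))]
    [∀ γ : ((UnitaryGroup.cmDatum L 3 H').Local v), BorelSpace (((UnitaryGroup.cmDatum L 3 H').Local v) ⧸ Subgroup.centralizer ({γ} : Set ((UnitaryGroup.cmDatum L 3 H').Local v)))]
    (νG : Measure ((UnitaryGroup.cmDatum L 3 H').Local v)) [νG.IsHaarMeasure] [νG.IsMulRightInvariant]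
    (νH : Measure ((UnitaryGroup.cmDatum L 2 (Matrix.of fun i j : Fin 2 => if i.val + j.val + 1 = 2 then (1 : L) else 0)).Local v ×
      (UnitaryGroup.cmDatum L 1 (Matrix.of fun i j : Fin 1 => if i.val + j.val + 1 = 1 then (1 : L) else 0)).Local v))
    [νH.IsHaarMeasure] [νH.IsMulRightInvariant]
    (mH : OrbitalMeasureFamily ((UnitaryGroup.cmDatum L 2 (Matrix.of fun i j : Fin 2 => if i.val + j.val + 1 = 2 then (1 : L) else 0)).Local v ×
      (UnitaryGroup.cmDatum L 1 (Matrix.of fun i j : Fin 1 => if i.val + j.val + 1 = 1 then (1 : L) else 0)).Local v))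
    (mG : OrbitalMeasureFamily ((UnitaryGroup.cmDatum L 3 H').Local v))
    (hm : mH.IsCanonical (IsLocalGRegular L v) νH ∧
      mG.IsCanonical (fun γ => IsRegularElt (γ.val : GL (Fin 3) (UnitaryGroup.LocalRing L v))) νG)
    (ρ : Finset (IrrClass ((UnitaryGroup.cmDatum L 2 (Matrix.of fun i j : Fin 2 => if i.val + j.val + 1 = 2 then (1 : L) else 0)).Local v ×
      (UnitaryGroup.cmDatum L 1 (Matrix.of fun i j : Fin 1 => if i.val + j.val + 1 = 1 then (1 : L) else 0)).Local v))) :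
    ∀ (χ₂ : ↥(torusU (conjLocal L (IsCMField.complexConj L) v) (cmLocalForm L 2 v)) →* ℂˣ)
        (χ₁ : (UnitaryGroup.cmDatum L 1 (Matrix.of fun i j : Fin 1 => if i.val + j.val + 1 = 1 then (1 : L) else 0)).Local v →* ℂˣ),
        IsOpen ((χ₁.ker : Subgroup ((UnitaryGroup.cmDatum L 1 (Matrix.of fun i j : Fin 1 => if i.val + j.val + 1 = 1 then (1 : L) else 0)).Local v)) : Set ((UnitaryGroup.cmDatum L 1 (Matrix.of fun i j : Fin 1 => if i.val + j.val + 1 = 1 then (1 : L) else 0)).Local v)) →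
        (∃ σ ∈ ρ, σ.IsConstituentOf (cmPrincipalSeriesH L v χ₂ χ₁)) →
        ∃ (ε : ℤ) (W : Type) (_ : AddCommGroup W) (_ : Module ℂ W) (I : Representation ℂ ((UnitaryGroup.cmDatum L 3 H').Local v) W),
          I.IsAdmissible ∧ IsFiniteLength (MonoidAlgebra ℂ ((UnitaryGroup.cmDatum L 3 H').Local v)) I.asModule ∧
          ∀ (fH : (UnitaryGroup.cmDatum L 2 (Matrix.of fun i j : Fin 2 => if i.val + j.val + 1 = 2 then (1 : L) else 0)).Local v ×
              (UnitaryGroup.cmDatum L 1 (Matrix.of fun i j : Fin 1 => if i.val + j.val + 1 = 1 then (1 : L) else 0)).Local v → ℂ)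
            (f : (UnitaryGroup.cmDatum L 3 H').Local v → ℂ),
            IsLocSmooth fH → IsLocSmooth f →
              IsLocalDeltaTransfer L H' v
                (finExplicitCollection L H' μ (finExplicitDelta_conj_left_all L H' μ) (finExplicitDelta_conj_right_all L H' μ) v) mH mG fH f →
              (cmPrincipalSeriesH L v χ₂ χ₁).smoothTrace νH fH = (ε : ℂ) * I.smoothTrace νG f := by
  intro χ₂ χ₁ hχ₁ hσ
  obtain ⟨σ, -, hσc⟩ := hσ
  have hχ₂ := continuous_of_isConstituentOf_cmPrincipalSeriesH L v χ₂ χ₁ σ hσc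
  exact print_492_indPS_of_signedTransfer L H' v hH' hH'd μ hv νG νH mH mG χ₂ χ₁
    (inducedCharTransferSigned_general L H' μ v νG νH hμω hH' hH'd mH mG hm hv χ₂ hχ₂ χ₁ hχ₁)

end Summit.HodgeConjecture.HodgeConjecture.R90.S3

end
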